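import Summits.CriticalPhenomena.PercolationContinuityZ3.Theorems.Transplant.KNLevelsStepII
import Summits.CriticalPhenomena.PercolationContinuityZ3.Theorems.Transplant.BoxProdZ2Boxes
import HarnessLib

/-!
# F5/F6-prod instance — Kozma–Nitzan Lemma 10 over `X □ ℤ²`: the TUBE GRAPH over a fibre window, its planar levels
# `B⟨j⟩ = π × Icc (lo - j) (hi + j)`, the level axioms, Step II for tube levels, and the transfer of window-local probabilities
# (BLUEPRINT-I-PHI §6 Target 1, §1 rows `B⟨j⟩` / `IsSubbox` with amendment (A): "D := the full cell window")

builds on p205010 (kernel theorem, internal audit signed; external expert review pending) — nothing in this file uses p205010.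
Lane `prim-bschramm`, seat `prim-bschramm-p3` (task F6 (b), split agreed with p2-g2 07:45Z/07:55Z); helper file
(`--supports stmt-CriticalPhenomena-4575 --as helper`).

Design (agreed p2-g2/p3-g2, STATUS 07:55Z): Lemma 10 for `X □ ℤ²` runs in the TUBE GRAPH `tubeGraph X π` over the cell's finite fibre window
`π ⊆ W` — the edges of `X □ ℤ²` whose endpoints both have fibre coordinate in `π`, on the SAME vertex type `W × Site 2` — with the
planar-only levels `tubeLevel π lo hi j = π ×ˢ Icc (lo - j) (hi + j)` (full window in the fibre).  In this graph the outer vertex boundary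
of a level consists of MACRO contacts only (`mem_outerBoundary_tubeLevel_iff`) and lies in the next level, so the generic files
`KNLevelsDefs` / `KNLevelsLocality` / `KNLevelsStepII` (p210475 / p211058 / p211364) apply; a subbox `D = π ×ˢ (square)` of a weighting
in the tube graph has exterior attachments on its macro inner boundary only (amendment (A)).  Contents:
* §1 `tubeGraph X π`: adjacency, `tubeGraph_le`, local finiteness, degrees `≤ Δ_X + 4` (`degree_tubeGraph_le`, via p2's `ProdKN.degree_prod_le`);
* §2 `tubeLevel`, `mem_outerBoundary_tubeLevel_iff` (outer boundary = `π ×` planar outer boundary), the level axioms `tubeLevel_monotone`,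
  `tubeLevel_nest`, the inner boundary of `π ×ˢ Icc lo hi` in the tube graph (macro only);
* §3 `tubeLData`, `lhyp_tube` (the generic `KNLevels.LHyp`), **`stepII_tube`** (Step II for tube levels, degree bound `Δ_X + 4`);
* §4 `real_eq_of_determinedBy_window`: an event determined by the pairs inside `π × ℤ²` has the same probability under
  `bondPercolation (tubeGraph X π) p` and `bondPercolation (X □ zdGraph 2) p` (so p2's Φ2-prod / F4-prod inputs transfer).

[cite: KozmaNitzan2024, §4 Lemma 10, pp. 17–18 (Steps I–II), p. 15 (B⟨R⟩), p. 17 (subbox) — the ℤ^d model] [cite: GrimmettPercolation1999, §7.2]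
-/

noncomputable section

open MeasureTheory ProbabilityTheory
open scoped ENNReal

namespace Summit.CriticalPhenomena.PercolationContinuityZ3.Theorems

namespace Transplant

namespace BoxProdZ2

open Literature.Probability.Percolation Literature.Probability.LatticeModels SimpleGraph
open KNLevels

variable {W : Type*} [DecidableEq W] (X : SimpleGraph W) [X.LocallyFinite]

/-! ## §1 The tube graph over a fibre window -/

omit [DecidableEq W] [X.LocallyFinite] in
/-- **The tube graph over the fibre window `π`**: the edges of `X □ ℤ²` both of whose endpoints have fibre coordinate in `π` (a subgraph
on the same vertex type; vertices off the tube are isolated). [cite: KozmaNitzan2024, §4 p. 17 (subbox: the induced graph on D)] -/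
def tubeGraph (π : Finset W) : SimpleGraph (W × Site 2) where
  Adj u v := (X □ zdGraph 2).Adj u v ∧ u.1 ∈ π ∧ v.1 ∈ π
  symm := ⟨fun _ _ h => ⟨h.1.symm, h.2.2, h.2.1⟩⟩
  loopless := ⟨fun _ h => h.1.ne rfl⟩

omit [DecidableEq W] [X.LocallyFinite] in
/-- Adjacency in the tube graph. [folklore] -/
theorem tubeGraph_adj {π : Finset W} {u v : W × Site 2} :
    (tubeGraph X π).Adj u v ↔ (X □ zdGraph 2).Adj u v ∧ u.1 ∈ π ∧ v.1 ∈ π := Iff.rfl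

omit [DecidableEq W] [X.LocallyFinite] in
/-- The tube graph is a subgraph of `X □ ℤ²`. [folklore] -/
theorem tubeGraph_le (π : Finset W) : tubeGraph X π ≤ X □ zdGraph 2 := fun _ _ h => h.1

omit [DecidableEq W] [X.LocallyFinite] in
/-- Edges of the tube graph are edges of `X □ ℤ²`. [folklore] -/
theorem edgeSet_tubeGraph_subset (π : Finset W) : (tubeGraph X π).edgeSet ⊆ (X □ zdGraph 2).edgeSet :=
  SimpleGraph.edgeSet_mono (tubeGraph_le X π)

/-- The tube graph is locally finite (its neighbour sets are those of `X □ ℤ²` cut down to the tube). [folklore] -/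
instance tubeGraph_locallyFinite (π : Finset W) : (tubeGraph X π).LocallyFinite := fun v =>
  Fintype.ofFinset (((X □ zdGraph 2).neighborFinset v).filter fun w => v.1 ∈ π ∧ w.1 ∈ π) fun w => by
    simp only [Finset.mem_filter, SimpleGraph.mem_neighborFinset, SimpleGraph.mem_neighborSet, tubeGraph_adj]

/-- Degrees in the tube graph are at most those in `X □ ℤ²`, hence `≤ Δ_X + 4`. [folklore] -/
theorem degree_tubeGraph_le {Δ : ℕ} (hΔ : ∀ w, X.degree w ≤ Δ) (π : Finset W) (v : W × Site 2) :
    (tubeGraph X π).degree v ≤ Δ + 4 :=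
  (SimpleGraph.degree_le_of_le (tubeGraph_le X π)).trans (ProdKN.degree_prod_le X hΔ v)

/-! ## §2 The planar levels over the window -/

omit [DecidableEq W] [X.LocallyFinite] in
/-- **The tube levels** `B⟨j⟩ := π × Icc (lo - j) (hi + j)`: KN's enlarged boxes in the plane, full window in the fibre.
[cite: KozmaNitzan2024, §4 p. 15 (B⟨R⟩)] -/
def tubeLevel (π : Finset W) (lo hi : Site 2) (j : ℕ) : Finset (W × Site 2) :=
  π ×ˢ Finset.Icc (lo - (j : Site 2)) (hi + (j : Site 2))

omit [DecidableEq W] [X.LocallyFinite] in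
/-- Membership in a tube level. [folklore] -/
theorem mem_tubeLevel_iff {π : Finset W} {lo hi : Site 2} {j : ℕ} {v : W × Site 2} :
    v ∈ tubeLevel π lo hi j ↔ v.1 ∈ π ∧ v.2 ∈ Finset.Icc (lo - (j : Site 2)) (hi + (j : Site 2)) := by
  rw [tubeLevel, Finset.mem_product]

omit [DecidableEq W] [X.LocallyFinite] in
/-- Level `0` is `π × Icc lo hi`. [folklore] -/
theorem tubeLevel_zero (π : Finset W) (lo hi : Site 2) : tubeLevel π lo hi 0 = π ×ˢ Finset.Icc lo hi := by
  simp [tubeLevel]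

/-- **Outer boundary of a window-full product set in the tube graph = window × planar outer boundary** (MACRO contacts only: a tube edge
leaving `π × Λ` is a planar edge). [cite: KozmaNitzan2024, §4 p. 15 (∂_ev B)] -/
theorem mem_outerBoundary_tube_iff {π : Finset W} {Λ : Finset (Site 2)} {x : W × Site 2} :
    x ∈ outerBoundary (tubeGraph X π) (π ×ˢ Λ) ↔ x.1 ∈ π ∧ x.2 ∈ outerBoundary (zdGraph 2) Λ := by
  rw [mem_outerBoundary_iff, mem_outerBoundary_iff, Finset.mem_product]
  constructor
  · rintro ⟨hx, y, hy, hxy⟩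
    rw [Finset.mem_product] at hy
    obtain ⟨hadj, hx1, -⟩ := (tubeGraph_adj X).1 hxy
    rcases SimpleGraph.boxProd_adj.1 hadj with ⟨-, h2⟩ | ⟨h2, h1⟩
    · exact absurd ⟨hx1, h2 ▸ hy.2⟩ hx
    · exact ⟨hx1, fun h => hx ⟨hx1, h⟩, y.2, hy.2, h2⟩
  · rintro ⟨hx1, hx2, t, ht, hxt⟩
    refine ⟨fun h => hx2 h.2, (x.1, t), Finset.mem_product.2 ⟨hx1, ht⟩, ?_⟩
    exact (tubeGraph_adj X).2 ⟨SimpleGraph.boxProd_adj.2 (Or.inr ⟨hxt, rfl⟩), hx1, hx1⟩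

/-- Outer boundary of a tube level: window × planar outer boundary of the planar box. [folklore] -/
theorem mem_outerBoundary_tubeLevel_iff {π : Finset W} {lo hi : Site 2} {j : ℕ} {x : W × Site 2} :
    x ∈ outerBoundary (tubeGraph X π) (tubeLevel π lo hi j) ↔
      x.1 ∈ π ∧ x.2 ∈ outerBoundary (zdGraph 2) (Finset.Icc (lo - (j : Site 2)) (hi + (j : Site 2))) :=
  mem_outerBoundary_tube_iff X

omit [DecidableEq W] [X.LocallyFinite] in
/-- **Level axiom 1**: the tube levels increase. [folklore] -/
theorem tubeLevel_monotone (π : Finset W) (lo hi : Site 2) : Monotone (tubeLevel π lo hi) := by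
  intro j j' h
  refine Finset.product_subset_product le_rfl (Finset.Icc_subset_Icc (fun i => ?_) (fun i => ?_)) <;>
    simp only [Pi.sub_apply, Pi.add_apply, Pi.natCast_apply] <;> omega

/-- **Level axiom 2**: the outer boundary (in the tube graph) of `B⟨j⟩` lies in `B⟨j+1⟩`. [cite: KozmaNitzan2024, §4 p. 15 (∂_ev B ⊆ B⟨1⟩)] -/
theorem tubeLevel_nest (π : Finset W) (lo hi : Site 2) (j : ℕ) :
    outerBoundary (tubeGraph X π) (tubeLevel π lo hi j) ⊆ tubeLevel π lo hi (j + 1) := by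
  intro x hx
  obtain ⟨hx1, hx2⟩ := (mem_outerBoundary_tubeLevel_iff X).1 hx
  rw [mem_tubeLevel_iff]
  refine ⟨hx1, ?_⟩
  have h := KozmaNitzan.mem_Icc_enlarge_one_of_mem_outerBoundary hx2
  refine Finset.Icc_subset_Icc (fun i => ?_) (fun i => ?_) h <;>
    simp only [Pi.sub_apply, Pi.add_apply, Pi.natCast_apply, Pi.one_apply] <;> push_cast <;> omega

/-- **Inner boundary of a window-full product set in the tube graph is MACRO**: `v ∈ ∂^{in}(π × Λ)` iff `v.1 ∈ π`, `v.2 ∈ Λ` and `v.2`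
has a planar neighbour outside `Λ` (amendment (A): exterior attachments of a subbox never touch the window ends).
[cite: KozmaNitzan2024, §4 p. 17 (∂_iv D)] -/
theorem mem_innerBoundary_tube_iff {π : Finset W} {Λ : Finset (Site 2)} {v : W × Site 2} :
    v ∈ innerBoundary (tubeGraph X π) (π ×ˢ Λ) ↔ v.1 ∈ π ∧ v.2 ∈ innerBoundary (zdGraph 2) Λ := by
  rw [mem_innerBoundary_iff, mem_innerBoundary_iff, Finset.mem_product]
  constructor
  · rintro ⟨⟨hv1, hv2⟩, y, hy, hvy⟩
    rw [Finset.mem_product] at hy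
    obtain ⟨hadj, -, hy1⟩ := (tubeGraph_adj X).1 hvy
    rcases SimpleGraph.boxProd_adj.1 hadj with ⟨-, h2⟩ | ⟨h2, -⟩
    · exact absurd ⟨hy1, h2 ▸ hv2⟩ hy
    · exact ⟨hv1, hv2, y.2, fun h => hy ⟨hy1, h⟩, h2⟩
  · rintro ⟨hv1, hv2, t, ht, hvt⟩
    refine ⟨⟨hv1, hv2⟩, (v.1, t), fun h => ht (Finset.mem_product.1 h).2, ?_⟩
    exact (tubeGraph_adj X).2 ⟨SimpleGraph.boxProd_adj.2 (Or.inr ⟨hvt, rfl⟩), hv1, hv1⟩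

/-! ## §3 The level data, the hypotheses of Lemma 10, Step II for tube levels -/

omit [DecidableEq W] [X.LocallyFinite] in
/-- **The level data in the tube graph**: levels `tubeLevel π lo hi`, source `o`, support `Sfin`. [cite: KozmaNitzan2024, §4 Lemma 10 (p. 17)] -/
def tubeLData (π : Finset W) (lo hi : Site 2) (o : W × Site 2) (Sfin : Finset (W × Site 2)) : LData (tubeGraph X π) :=
  ⟨tubeLevel π lo hi, o, Sfin⟩

omit [DecidableEq W] [X.LocallyFinite] in
/-- The levels of `tubeLData`. [folklore] -/
@[simp] theorem tubeLData_X (π : Finset W) (lo hi : Site 2) (o : W × Site 2) (Sfin : Finset (W × Site 2)) :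
    (tubeLData X π lo hi o Sfin).X = tubeLevel π lo hi := rfl

omit [DecidableEq W] [X.LocallyFinite] in
/-- The source of `tubeLData`. [folklore] -/
@[simp] theorem tubeLData_o (π : Finset W) (lo hi : Site 2) (o : W × Site 2) (Sfin : Finset (W × Site 2)) :
    (tubeLData X π lo hi o Sfin).o = o := rfl

omit [DecidableEq W] [X.LocallyFinite] in
/-- The support of `tubeLData`. [folklore] -/
@[simp] theorem tubeLData_Sfin (π : Finset W) (lo hi : Site 2) (o : W × Site 2) (Sfin : Finset (W × Site 2)) :
    (tubeLData X π lo hi o Sfin).Sfin = Sfin := rfl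

omit [DecidableEq W] [X.LocallyFinite] in
/-- `{o ↔ B}` for the tube data is `{o ↔ π × Icc lo hi}`. [folklore] -/
theorem reachB_tubeLData (π : Finset W) (lo hi : Site 2) (o : W × Site 2) (Sfin : Finset (W × Site 2)) :
    (tubeLData X π lo hi o Sfin).reachB = ⋃ b ∈ π ×ˢ Finset.Icc lo hi, openConn o b := by
  rw [LData.reachB, tubeLData_X, tubeLevel_zero]; rfl

/-- **The hypotheses of Lemma 10 for tube levels**: a subbox `D ⊇ B⟨R+1⟩` (in the tube graph) of a finitely supported weighting at
parameter `p` and a source `o ∈ Sfin \ D` give `KNLevels.LHyp`. [cite: KozmaNitzan2024, §4 Lemma 10 (p. 17)] -/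
theorem lhyp_tube (π : Finset W) (lo hi : Site 2) {o : W × Site 2} {Sfin D : Finset (W × Site 2)}
    {Wt : Sym2 (W × Site 2) → unitInterval} {p : unitInterval} {R : ℕ}
    (hsub : IsSubbox (tubeGraph X π) Wt p D) (hfin : FinSupp Wt Sfin) (hDS : D ⊆ Sfin)
    (hencl : tubeLevel π lo hi (R + 1) ⊆ D) (ho : o ∉ D) (hoS : o ∈ Sfin) :
    LHyp (tubeLData X π lo hi o Sfin) Wt p D R where
  mono := tubeLevel_monotone π lo hi
  nest := tubeLevel_nest X π lo hi
  sub := hsub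
  fin := hfin
  DS := hDS
  encl := hencl
  o_not := ho
  o_mem := hoS

/-- **Kozma–Nitzan's Step II over the tube levels of `X □ ℤ²`** (`X` locally finite with degrees `≤ Δ`, countably many vertices): for a
finitely supported weighting `Wt` with a subbox `D ⊇ B⟨R+1⟩` in the tube graph over `π` at parameter `p < 1` and a source `o ∈ Sfin \ D`,
if `P_Wt(o ↔ π × Icc lo hi) > 1 - δ` and the level range `[j₀, j₁]`, `j₁ ≤ R`, has at least `(1-p)^{-(Δ+4)N}/δ` levels, then at some level
`j` there are at least `N` (macro) contact vertices joined to `o` outside `B⟨j⟩` with probability `> 1 - 2δ`.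
[cite: KozmaNitzan2024, §4 p. 18 (Step II)] -/
theorem stepII_tube [Countable W] {Δ : ℕ} (hΔ : ∀ w, X.degree w ≤ Δ)
    (π : Finset W) (lo hi : Site 2) {o : W × Site 2} {Sfin D : Finset (W × Site 2)}
    {Wt : Sym2 (W × Site 2) → unitInterval} {p : unitInterval} {R : ℕ}
    (hsub : IsSubbox (tubeGraph X π) Wt p D) (hfin : FinSupp Wt Sfin) (hDS : D ⊆ Sfin)
    (hencl : tubeLevel π lo hi (R + 1) ⊆ D) (ho : o ∉ D) (hoS : o ∈ Sfin)
    (hp1 : (p : ℝ) < 1) {N j₀ j₁ : ℕ} (hj₁ : j₁ ≤ R) {δ : ℝ}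
    (hJ : 1 / (1 - (p : ℝ)) ^ ((Δ + 4) * N) ≤ δ * ((Finset.Icc j₀ j₁).card : ℝ))
    (hreach : 1 - δ < (prodBernoulli Wt).real (⋃ b ∈ π ×ˢ Finset.Icc lo hi, openConn o b)) :
    ∃ j ∈ Finset.Icc j₀ j₁, 1 - 2 * δ < (prodBernoulli Wt).real {ω | N ≤ ((tubeLData X π lo hi o Sfin).Kont j ω).card} := by
  have hL := lhyp_tube X π lo hi hsub hfin hDS hencl ho hoS
  rw [← reachB_tubeLData X π lo hi o Sfin] at hreach
  exact hL.stepII (degree_tubeGraph_le X hΔ π) hp1 hj₁ hJ hreach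

/-! ## §4 Transfer of window-local probabilities between the tube graph and `X □ ℤ²` -/

omit [DecidableEq W] [X.LocallyFinite] in
/-- On the off-diagonal pairs inside the tube `π × ℤ²` the graph weightings of the tube graph and of `X □ ℤ²` agree. [folklore] -/
theorem lattW_tubeGraph_eq {π : Finset W} (p : unitInterval) {e : Sym2 (W × Site 2)}
    (he : e ∈ wireSet {v : W × Site 2 | v.1 ∈ π}) : lattW (tubeGraph X π) p e = lattW (X □ zdGraph 2) p e := by
  classical
  induction e using Sym2.ind with
  | h u v =>
    obtain ⟨hu, hv, -⟩ := mk_mem_wireSet_iff.1 he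
    by_cases h : (X □ zdGraph 2).Adj u v
    · rw [lattW_mk_of_adj _ p h, lattW_mk_of_adj _ p ((tubeGraph_adj X).2 ⟨h, hu, hv⟩)]
    · rw [lattW_mk_of_not_adj _ p h, lattW_mk_of_not_adj _ p (fun h' => h ((tubeGraph_adj X).1 h').1)]

omit [DecidableEq W] [X.LocallyFinite] in
/-- **Transfer**: an event determined by the pairs inside the tube `π × ℤ²` has the same probability under bond percolation on the tube
graph and on `X □ ℤ²` (so the uniqueness-zone / linked-face / hittability inputs proved for `X □ ℤ²` serve the tube graph).
[cite: KozmaNitzan2024, §4 p. 17 ("the induced graph on D is isomorphic to …")] -/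
theorem real_eq_of_determinedBy_window {π : Finset W} (p : unitInterval) {A : Set (BondConfig (W × Site 2))}
    (hA : DeterminedBy A (wireSet {v : W × Site 2 | v.1 ∈ π})) (hAm : MeasurableSet A) :
    (bondPercolation (tubeGraph X π) p).real A = (bondPercolation (X □ zdGraph 2) p).real A := by
  rw [← prodBernoulli_lattW, ← prodBernoulli_lattW]
  exact prodBernoulli_real_eq_of_determinedBy _ _ (fun e he => lattW_tubeGraph_eq X p he) hA hAm

end BoxProdZ2

end Transplant

end Summit.CriticalPhenomena.PercolationContinuityZ3.Theorems

end
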